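import Literature.NumberTheory.LFunctions.ZeroDensityNearOneLogPowerTools
import Literature.NumberTheory.LFunctions.ZeroDensityNearOneTools
import Literature.NumberTheory.LFunctions.GuthMaynardPsiShortIntervalsProofs
import Literature.NumberTheory.LFunctions.GuthMaynardPrimesShortIntervalsProofs
import Literature.NumberTheory.LFunctions.GuthMaynardPsiMeanSquareProofs
import Literature.NumberTheory.LFunctions.GuthMaynardPrimesAlmostAllProofs
import HarnessLib

/-!
# Zero density near `σ = 1` with logarithmic losses only, and Guth–Maynard's combined bound (13.3)

NOT RH-BEARING (D-0040; bears_on LADDER-RH §4 HELD row `DensityLadder`, stmt-19600): a density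
theorem counts zeros off the critical line, it never empties the strip (Barrier `LindelofBacklund`);
corpus theorems are RH-FREE literature and nothing in this file is worded as progress toward RH.

Topic `NumberTheory/LFunctions`, corpus C4 (Guth–Maynard 2024/2026, §13.2), "road B" of the cell's
plan for the ONE hypothesis left under the prime corollaries Cor. 1.3/1.4: the combined density bound

> (13.3) `N(σ, T) ≪ T^{(30/13+o(1))(1−σ)} (log T)^{O(1)}` uniformly for `1/2 ≤ σ ≤ 1`

(arXiv:2405.20552v2 p. 50, display (13.3); v1 §13.2, the display after "By combining (1.4) with a
slightly stronger result (such as [J] or [M3, Theorem 12.1]) that loses at most logarithmic factors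
for `σ` closer to `1`"). The tree holds the `30/13` theorem in the `T^ε` form made uniform in `σ`
(`zetaZeroCountRe_le_thirty_thirteenths_uniform`, `ZeroDensityNearOne.lean`); the `T^ε` loss is
harmless away from `σ = 1` (`T^{η/20} ≤ T^{η(1−σ)}` for `1 − σ ≥ 1/20`) but not near `σ = 1`, where
a bound with LOGARITHMIC losses only and any exponent `A₀ < 30/13` is needed. This file proves such a
bound of density-hypothesis strength, `A₀ = 2`, on `[19/20, 1]`:

* `zetaZeroCountRe_le_nearOne_logPower` — `∃ C B T₀, 0 < C ∧ N(σ, T) ≤ C T^{2(1−σ)} (log T)^B`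
  for `T ≥ T₀`, `19/20 ≤ σ ≤ 1` (landed with `C = 1`, `B = 24`);
* `GuthMaynard2026_eq_13_3` — the printed display (13.3) as a `Prop` (the shape consumed by the
  tree's `GuthMaynard2026.zeroSum_rpow_decay`, `…psiShortIntervals_of_combinedDensity`, …), and
  `GuthMaynard2026_eq_13_3_of_nearOne` / `GuthMaynard2026_eq_13_3_holds` — its proof by splicing
  the near-one log-power bound with the uniform `30/13` bound (net debt 0 at landing);
* §6 (block authored by seat rh-crit-gm-t9): the closing compositions of GM §13.2 —
  `GuthMaynard2026_corollary_1_3_holds`, `GuthMaynard2026_corollary_1_4_holds`,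
  `GuthMaynard2026_psiShortIntervals_holds`, `GuthMaynard2026_psiMeanSquareShort_holds` (the four
  interface facts of `GuthMaynardPrimeCorollaries.lean` DISCHARGED, net debt −4) and the prime
  corollaries `GuthMaynard2026_exists_prime_mem_Ioc`, `GuthMaynard2026_primeGap_le_rpow`.

## The proof of the log-power bound (Ingham–Huxley zero detection at `Re s = 1/2`, no `T^ε` anywhere)

Per dyadic block `U < γ ≤ 2U`, `T = 2U`, `l = log T`, with the FIXED parameters `X = ⌈T^{11/20}⌉₊`,
`Y = T`, `δ = 9/20` (so `β ≥ σ ≥ 19/20 = 1/2 + δ`):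
1. zero detection with the class (ii) condition as a short integral
   (`HuxleyZeroDensity.zeroDetection_integral`): every zero is of class (i),
   `|∑_{X<n≤⌊100 l Y⌋} a_X(n)e^{−n/Y} n^{−ρ}| > 1/3`, or
   `(9/20) Y^{β−1/2}/2²⁰ ≤ ∫_{|y|≤100 l} |ζ M_X(1/2 + i(γ+y))| dy`;
2. CLASS (ii) IS EMPTY: by Weyl's bound `|ζ(1/2+it)| ≪ t^{1/6} log t` and `|M_X(1/2+it)| ≤ 2√X` the
   integral is `≪ l² T^{1/6+11/40} = l² T^{53/120} < (9/20) T^{9/20}/2²⁰ ≤ (9/20) Y^{β−1/2}/2²⁰`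
   for `T ≥ T₀`, so EVERY zero of the block is of class (i) — this is
   `NearOneLogPower.classOne_of_zero` (`ZeroDensityNearOneLogPowerTools.lean`), imported;
3. the class (i) zeros are counted block by block by Huxley's large-values theorem with the
   MEAN-SQUARE divisor bound `∑_{M<n≤2M} d(n)² n^{−2σ} ≤ 2M^{1−2σ}(1+log 2M)³`
   (`ZeroDensity.sum_norm_sq_rpow_le_of_norm_le_divisors`) instead of `d(n) ≪ n^η`
   (`HuxleyZeroDensity.classOne_card_le_log`, §1 below, authored by seat rh-crit-gm-t6 =
   `HuxleyZeroDensity.classOne_card_le` so modified); with `Y = T`,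
   `X = T^{11/20}`: `≤ C l^{20}(T^{2(1−σ)} + T^{1+(11/20)(4−6σ)})`, and
   `1 + (11/20)(4−6σ) ≤ 2(1−σ) ⟺ σ ≥ 12/13` (`classOne_bound_absorb`);
4. thinning of a `1`-separated set into `⌈300 l⌉ + 1` classes `3·100 l` apart
   (`HuxleyZeroDensity.card_le_of_thinning`);
5. the σ-UNIFORM counting layer `ZeroDensity.zetaZeroCountRe_le_of_wellSpaced_uniform`
   (`ZeroDensityNearOneTools.lean`): unit windows, `log₂ T + 1` dyadic blocks, one `T₀` for all `σ`.

## References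

* L. Guth, J. Maynard, *New large value estimates for Dirichlet polynomials*, Ann. of Math. (2) 203
  (2026) 623–675 = arXiv:2405.20552; v2 p. 50 display (13.3), v1 §13.2 (held chunk p0029:L16).
  [GuthMaynard2026]
* M. N. Huxley, *The Distribution of Prime Numbers* (1972), Ch. 23, Ch. 28 (28.1)–(28.16) — the
  zero-detection / large-values machinery reused from `HuxleyZeroDensity.lean`. [Huxley1972]
* A. Ivić, *The Riemann Zeta-Function* (1985), §11.2 (11.11)–(11.12) (counting layer), Thm. 11.1.
  [Ivic1985]
-/

noncomputable section

open Real Set Filter Topology Complex MeasureTheory Finset Asymptotics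

namespace Literature.NumberTheory.LFunctions

open HuxleyZeroDetection
open ZeroDetect (mollifier mollCoeff norm_mollCoeff_le)

/-! ## The printed display (13.3) -/

/-- **Guth–Maynard (13.3), the combined density bound**, as printed (arXiv:2405.20552v2 p. 50;
v1 §13.2): "`N(σ, T) ≪ T^{(30/13+o(1))(1−σ)} (log T)^{O(1)}`" uniformly on `1/2 ≤ σ ≤ 1` — rendered:
for every `η > 0` there are `C, B, T₀` with `N(σ, T) ≤ C T^{(30/13+η)(1−σ)} (log T)^B` for all
`T ≥ T₀` and `1/2 ≤ σ ≤ 1` (`N(σ, T) = zetaZeroCountRe σ T`). This is VERBATIM the hypothesis `hcomb`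
of the tree's §13.2 files (`GuthMaynardZeroSumDecay.lean`, `GuthMaynardPsiShortIntervalsProofs.lean`,
`GuthMaynardPsiMeanSquareProofs.lean`), which therefore consume `GuthMaynard2026_eq_13_3_holds` by
`defeq`. Printed provenance: "(1.4) + [Ju] or [M3, Theorem 12.1]"; proved below from the tree's
uniform `30/13` theorem and the log-power near-one bound of this file.
[cite: GuthMaynard2026, §13.2 display (13.3) (arXiv v2 p. 50 = v1 chunk p0029:L16)] -/
def GuthMaynard2026_eq_13_3 : Prop :=
  ∀ η : ℝ, 0 < η → ∃ C B T₀ : ℝ, ∀ T : ℝ, T₀ ≤ T → ∀ σ : ℝ, 1 / 2 ≤ σ → σ ≤ 1 →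
    (zetaZeroCountRe σ T : ℝ) ≤ C * T ^ ((30 / 13 + η) * (1 - σ)) * Real.log T ^ B

/-- **Splicing**: a near-one bound `N(σ,T) ≤ C₂ T^{A₀(1−σ)} (log T)^B` on `[1 − δ₁, 1]` (`T ≥ T₂`) with
`A₀ ≤ 30/13`, `0 < δ₁ ≤ 1/2`, together with the tree's uniform `30/13` theorem
(`zetaZeroCountRe_le_thirty_thirteenths_uniform`, used with `η' = η δ₁ ≤ η(1−σ)` on `[1/2, 1−δ₁]`),
gives (13.3) (with the exponent `max B 0` of the logarithm).
[cite: GuthMaynard2026, §13.2 display (13.3) (arXiv v2 p. 50)] -/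
theorem GuthMaynard2026_eq_13_3_of_nearOne {A₀ δ₁ C₂ B T₂ : ℝ} (hA₀ : A₀ ≤ 30 / 13)
    (hδ₁ : 0 < δ₁) (hδ₁' : δ₁ ≤ 1 / 2)
    (hnear : ∀ T : ℝ, T₂ ≤ T → ∀ σ : ℝ, 1 - δ₁ ≤ σ → σ ≤ 1 →
      (zetaZeroCountRe σ T : ℝ) ≤ C₂ * T ^ (A₀ * (1 - σ)) * Real.log T ^ B) :
    GuthMaynard2026_eq_13_3 := by
  intro η hη
  obtain ⟨C₁, T₁, hC₁, h30⟩ := zetaZeroCountRe_le_thirty_thirteenths_uniform (η * δ₁) (by positivity)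
  refine ⟨max C₁ (max C₂ 0), max B 0, max (max T₁ T₂) (Real.exp 1), fun T hT σ hσ hσ1 => ?_⟩
  have hTT₁ : T₁ ≤ T := le_trans (le_max_left _ _) (le_trans (le_max_left _ _) hT)
  have hTT₂ : T₂ ≤ T := le_trans (le_max_right _ _) (le_trans (le_max_left _ _) hT)
  have hTe : Real.exp 1 ≤ T := le_trans (le_max_right _ _) hT
  have hT0 : 0 < T := lt_of_lt_of_le (Real.exp_pos 1) hTe
  have hT1 : 1 ≤ T := by linarith [Real.add_one_le_exp (1 : ℝ)]
  have hL1 : 1 ≤ Real.log T := by rwa [Real.le_log_iff_exp_le hT0]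
  have hL0 : 0 ≤ Real.log T := by linarith
  have hLB : 1 ≤ Real.log T ^ max B 0 := Real.one_le_rpow hL1 (le_max_right _ _)
  have hLB' : Real.log T ^ B ≤ Real.log T ^ max B 0 :=
    Real.rpow_le_rpow_of_exponent_le hL1 (le_max_left _ _)
  have hC : 0 ≤ max C₁ (max C₂ 0) := le_max_of_le_right (le_max_right _ _)
  rcases lt_or_ge σ (1 - δ₁) with hlow | hhigh
  · -- away from one: the uniform `30/13` bound with `η δ₁ ≤ η (1 − σ)`
    have h := h30 T hTT₁ σ hσ hσ1
    have hexp : 30 / 13 * (1 - σ) + η * δ₁ ≤ (30 / 13 + η) * (1 - σ) := by nlinarith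
    calc (zetaZeroCountRe σ T : ℝ) ≤ C₁ * T ^ (30 / 13 * (1 - σ) + η * δ₁) := h
      _ ≤ max C₁ (max C₂ 0) * T ^ ((30 / 13 + η) * (1 - σ)) * 1 := by
          rw [mul_one]
          exact mul_le_mul (le_max_left _ _) (Real.rpow_le_rpow_of_exponent_le hT1 hexp)
            (by positivity) hC
      _ ≤ max C₁ (max C₂ 0) * T ^ ((30 / 13 + η) * (1 - σ)) * Real.log T ^ max B 0 :=
          mul_le_mul_of_nonneg_left hLB (by positivity)
  · -- near one: the log-power bound, `A₀ (1−σ) ≤ (30/13 + η)(1−σ)`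
    have h := hnear T hTT₂ σ hhigh hσ1
    have hexp : A₀ * (1 - σ) ≤ (30 / 13 + η) * (1 - σ) := by nlinarith
    calc (zetaZeroCountRe σ T : ℝ) ≤ C₂ * T ^ (A₀ * (1 - σ)) * Real.log T ^ B := h
      _ ≤ max C₁ (max C₂ 0) * T ^ ((30 / 13 + η) * (1 - σ)) * Real.log T ^ max B 0 := by
          apply mul_le_mul _ hLB' (Real.rpow_nonneg hL0 _) (by positivity)
          exact mul_le_mul (le_trans (le_max_left _ _) (le_max_right _ _))
            (Real.rpow_le_rpow_of_exponent_le hT1 hexp) (by positivity) hC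

/-! ## §1. The class (i) count with the mean-square divisor bound — §(iii) block authored by rh-crit-gm-t6 g2

Huxley (28.13)–(28.16) with logarithms kept. This section is the text of
`gm/scratch-t6/HuxleyClassOneLogPower.lean` (sha16 `0ef3bd6281e346ae`, seat rh-crit-gm-t6 g2), pasted
verbatim into this file per the cell lead's ruling A1.1 (one proposal, no extra olean hop); it lives
in the namespace `HuxleyZeroDensity`, next to the original `HuxleyZeroDensity.classOne_card_le`
(pointwise `d(n) ≤ C_d n^η`), which it modifies only in the coefficient bound. -/

namespace HuxleyZeroDensity

/-- **The class (i) zeros, logarithms kept** (Huxley (28.13)–(28.16) with the mean-square divisor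
bound). Let `σ ≥ 3/4`, `T ≥ 1`, `X ≥ 1`, `1 ≤ N₀ < 2^J`, `|c(n)| ≤ d(n)`, and let `Z` be a finite set
of points `ρ = β + iγ`, `σ ≤ β < 1`, with ordinates pairwise between `log 2N₀` and `T` apart. The
number of `ρ ∈ Z` with `|∑_{X<n≤N₀} c(n) n^{-ρ}| > 1/3` is at most
`J · C_b (36 J² (1 + log 2N₀)³ N₀^{2−2σ} + 11664 J⁶ T log⁴(2N₀T) (1 + log 2N₀)⁹ X^{4−6σ})`: split
`(X, N₀]` into dyadic blocks `(X2^i, X2^{i+1}]`, `i < J`; a class (i) point has a block with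
`|∑_{block}| > 1/(3J)` (`exists_block_large`); each block is counted by the large-values bound `hCb`
(`exists_block_largeValues_const`) with `G ≤ 2 M^{1−2σ}(1 + log 2M)³`
(`ZeroDensity.sum_norm_sq_rpow_le_of_norm_le_divisors`), and `M^{2−2σ} ≤ N₀^{2−2σ}`,
`M^{4−6σ} ≤ X^{4−6σ}` (`4 − 6σ ≤ 0`). [cite: Huxley1972, Ch. 28, (28.13)–(28.16)]
[cite: Ivic1985, (1.80)] -/
theorem classOne_card_le_log {C_b : ℝ} (hCb0 : 0 ≤ C_b)
    (hCb : ∀ (b : ℕ → ℂ) (M : ℕ) (σ T V : ℝ) (Z : Finset ℂ), 1 ≤ M → 1 ≤ T → 0 < V →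
    (∀ ρ ∈ Z, σ ≤ ρ.re ∧ ρ.re ≤ σ + 1 / 3) →
    (∀ ρ ∈ Z, ∀ ρ' ∈ Z, ρ ≠ ρ' → Real.log (2 * M) ≤ |ρ.im - ρ'.im| ∧ |ρ.im - ρ'.im| ≤ T) →
    (∀ ρ ∈ Z, V ≤ ‖∑ n ∈ Finset.Ioc M (2 * M), b n * (n : ℂ) ^ (-ρ)‖) →
    (Z.card : ℝ) ≤ C_b *
      ((∑ n ∈ Finset.Ioc M (2 * M), ‖b n‖ ^ 2 * (n : ℝ) ^ (-2 * σ)) * (2 * M) * V⁻¹ ^ 2 +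
        (∑ n ∈ Finset.Ioc M (2 * M), ‖b n‖ ^ 2 * (n : ℝ) ^ (-2 * σ)) ^ 3 * (2 * M) * T * V⁻¹ ^ 6 *
          Real.log (2 * M * T) ^ 4))
    {c : ℕ → ℂ} (hc : ∀ n, ‖c n‖ ≤ (n.divisors.card : ℝ))
    {σ T : ℝ} (hσ : 3 / 4 ≤ σ) (hσ1 : σ ≤ 1) (hT : 1 ≤ T) {X N₀ J : ℕ} (hX : 1 ≤ X) (hN₀ : 1 ≤ N₀)
    (hJ : N₀ < 2 ^ J) (Z : Finset ℂ) (hre : ∀ ρ ∈ Z, σ ≤ ρ.re ∧ ρ.re < 1)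
    (hsep : ∀ ρ ∈ Z, ∀ ρ' ∈ Z, ρ ≠ ρ' → Real.log (2 * N₀) ≤ |ρ.im - ρ'.im| ∧ |ρ.im - ρ'.im| ≤ T) :
    ((Z.filter (fun ρ ↦ 1 / 3 < ‖∑ n ∈ Finset.Ioc X N₀, c n * (n : ℂ) ^ (-ρ)‖)).card : ℝ) ≤
      J * (C_b * (36 * (J : ℝ) ^ 2 * (1 + Real.log (2 * N₀)) ^ 3 * (N₀ : ℝ) ^ (2 - 2 * σ) +
        11664 * (J : ℝ) ^ 6 * T * Real.log (2 * N₀ * T) ^ 4 * (1 + Real.log (2 * N₀)) ^ 9 *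
          (X : ℝ) ^ (4 - 6 * σ))) := by
  classical
  -- `J ≥ 1`
  have hJ1 : 1 ≤ J := by
    rcases Nat.eq_zero_or_pos J with h | h
    · subst h; simp at hJ; omega
    · exact h
  have hJ0 : (0 : ℝ) < J := by exact_mod_cast hJ1
  have hN₀0 : (0 : ℝ) < N₀ := by exact_mod_cast hN₀
  have hN₀1 : (1 : ℝ) ≤ N₀ := by exact_mod_cast hN₀
  have hX0 : (0 : ℝ) < X := by exact_mod_cast hX
  -- the truncated coefficients
  set c' : ℕ → ℂ := fun n ↦ if n ≤ N₀ then c n else 0 with hc'def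
  have hc' : ∀ n, ‖c' n‖ ≤ (n.divisors.card : ℝ) := by
    intro n; rw [hc'def]; dsimp only
    split_ifs
    · exact hc n
    · simp
  -- the blocks
  set B : ℕ → ℂ → ℂ := fun i ρ ↦ ∑ n ∈ Finset.Ioc (X * 2 ^ i) (X * 2 ^ (i + 1)), c' n * (n : ℂ) ^ (-ρ)
    with hBdef
  have hNXJ : N₀ ≤ X * 2 ^ J := by
    calc N₀ ≤ 2 ^ J := hJ.le
      _ = 1 * 2 ^ J := (one_mul _).symm
      _ ≤ X * 2 ^ J := Nat.mul_le_mul_right _ hX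
  have hsplit : ∀ ρ : ℂ, ∑ n ∈ Finset.Ioc X N₀, c n * (n : ℂ) ^ (-ρ) =
      ∑ i ∈ Finset.range J, B i ρ := by
    intro ρ
    have h1 : ∑ n ∈ Finset.Ioc X N₀, c n * (n : ℂ) ^ (-ρ) =
        ∑ n ∈ Finset.Ioc X (X * 2 ^ J), c' n * (n : ℂ) ^ (-ρ) := by
      have hsub : Finset.Ioc X N₀ ⊆ Finset.Ioc X (X * 2 ^ J) := fun n hn ↦ by
        simp only [Finset.mem_Ioc] at hn ⊢; exact ⟨hn.1, hn.2.trans hNXJ⟩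
      rw [← Finset.sum_subset hsub]
      · refine Finset.sum_congr rfl fun n hn ↦ ?_
        simp only [Finset.mem_Ioc] at hn
        rw [hc'def]; dsimp only; rw [if_pos hn.2]
      · intro n _ hn'
        simp only [Finset.mem_Ioc, not_and, not_le] at hn'
        rw [hc'def]; dsimp only
        rw [if_neg (by
          intro hle
          simp only [Finset.mem_Ioc] at *
          omega), zero_mul]
    rw [h1, ZeroDensity.sum_Ioc_mul_two_pow]
  set V : ℝ := 1 / (3 * (J : ℝ)) with hV
  have hV0 : 0 < V := by positivity
  set Zi : ℕ → Finset ℂ := fun i ↦ Z.filter (fun ρ ↦ V ≤ ‖B i ρ‖) with hZi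
  have hcover : Z.filter (fun ρ ↦ 1 / 3 < ‖∑ n ∈ Finset.Ioc X N₀, c n * (n : ℂ) ^ (-ρ)‖) ⊆
      (Finset.range J).biUnion Zi := by
    intro ρ hρ
    rw [Finset.mem_filter] at hρ
    rw [hsplit ρ] at hρ
    obtain ⟨i, hi, hlarge⟩ := exists_block_large hρ.2
    rw [Finset.mem_biUnion]
    exact ⟨i, hi, by rw [hZi, Finset.mem_filter]; exact ⟨hρ.1, hlarge.le⟩⟩
  -- the logarithm of the coefficient bound
  set L : ℝ := 1 + Real.log (2 * N₀) with hL
  have hL1 : 1 ≤ L := by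
    rw [hL]; have : 0 ≤ Real.log (2 * (N₀ : ℝ)) := Real.log_nonneg (by linarith); linarith
  -- the bound for one block
  set R : ℝ := C_b * (36 * (J : ℝ) ^ 2 * L ^ 3 * (N₀ : ℝ) ^ (2 - 2 * σ) +
      11664 * (J : ℝ) ^ 6 * T * Real.log (2 * N₀ * T) ^ 4 * L ^ 9 * (X : ℝ) ^ (4 - 6 * σ)) with hR
  have hlog2NT : 0 ≤ Real.log (2 * N₀ * T) :=
    Real.log_nonneg (by nlinarith [mul_le_mul hN₀1 hT zero_le_one hN₀0.le])
  have hR0 : 0 ≤ R := by rw [hR]; positivity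
  have hblock : ∀ i ∈ Finset.range J, ((Zi i).card : ℝ) ≤ R := by
    intro i _
    set M : ℕ := X * 2 ^ i with hM
    have hM1 : 1 ≤ M := by rw [hM]; exact Nat.one_le_iff_ne_zero.2 (by positivity)
    have hM0 : (0 : ℝ) < M := by exact_mod_cast hM1
    have hM1r : (1 : ℝ) ≤ M := by exact_mod_cast hM1
    have hblk : X * 2 ^ (i + 1) = 2 * M := by rw [hM]; ring
    by_cases hNM : N₀ ≤ M
    · -- empty block
      have hempty : Zi i = ∅ := by
        rw [Finset.eq_empty_iff_forall_notMem]
        intro ρ hρ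
        rw [hZi, Finset.mem_filter] at hρ
        have hB0 : B i ρ = 0 := by
          rw [hBdef]; dsimp only
          refine Finset.sum_eq_zero fun n hn ↦ ?_
          simp only [Finset.mem_Ioc] at hn
          rw [hc'def]; dsimp only
          rw [if_neg (by omega), zero_mul]
        rw [hB0, norm_zero] at hρ
        linarith [hρ.2]
      rw [hempty, Finset.card_empty, Nat.cast_zero]; exact hR0
    · rw [not_le] at hNM
      -- the large-values bound on the block `(M, 2M]`
      have hre' : ∀ ρ ∈ Zi i, σ ≤ ρ.re ∧ ρ.re ≤ σ + 1 / 3 := by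
        intro ρ hρ
        rw [hZi, Finset.mem_filter] at hρ
        have := hre ρ hρ.1
        exact ⟨this.1, by linarith [this.2]⟩
      have hsep' : ∀ ρ ∈ Zi i, ∀ ρ' ∈ Zi i, ρ ≠ ρ' →
          Real.log (2 * M) ≤ |ρ.im - ρ'.im| ∧ |ρ.im - ρ'.im| ≤ T := by
        intro ρ hρ ρ' hρ' hne
        rw [hZi, Finset.mem_filter] at hρ hρ'
        have h := hsep ρ hρ.1 ρ' hρ'.1 hne
        have hlog : Real.log (2 * M) ≤ Real.log (2 * N₀) :=
          Real.log_le_log (by positivity) (by exact_mod_cast (by omega : 2 * M ≤ 2 * N₀))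
        exact ⟨hlog.trans h.1, h.2⟩
      have hlarge' : ∀ ρ ∈ Zi i, V ≤ ‖∑ n ∈ Finset.Ioc M (2 * M), c' n * (n : ℂ) ^ (-ρ)‖ := by
        intro ρ hρ
        rw [hZi, Finset.mem_filter] at hρ
        have := hρ.2
        rw [hBdef] at this; dsimp only at this
        rwa [hblk] at this
      have hLV := hCb c' M σ T V (Zi i) hM1 hT hV0 hre' hsep' hlarge'
      -- the coefficient sum, by the mean square of `d(n)`
      set G : ℝ := ∑ n ∈ Finset.Ioc M (2 * M), ‖c' n‖ ^ 2 * (n : ℝ) ^ (-2 * σ) with hG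
      have hG0 : 0 ≤ G := Finset.sum_nonneg fun n _ ↦ by positivity
      set LM : ℝ := 1 + Real.log (2 * (M : ℝ)) with hLM
      have hLM0 : 0 ≤ LM := by
        rw [hLM]; have : 0 ≤ Real.log (2 * (M : ℝ)) := Real.log_nonneg (by linarith); linarith
      have hGle : G ≤ 2 * (M : ℝ) ^ (1 - 2 * σ) * LM ^ 3 := by
        have h := ZeroDensity.sum_norm_sq_rpow_le_of_norm_le_divisors hc' hM1 (σ := σ) (by linarith)
        rw [hLM]
        convert h using 3
        push_cast; ring
      -- sizes
      have h2M : (2 * (M : ℝ)) ≤ 2 * N₀ := by exact_mod_cast (by omega : 2 * M ≤ 2 * N₀)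
      have hMN : (M : ℝ) ≤ N₀ := by exact_mod_cast hNM.le
      have hXM : (X : ℝ) ≤ M := by
        rw [hM]; push_cast
        exact le_mul_of_one_le_right hX0.le (one_le_pow₀ (by norm_num))
      have hVinv : V⁻¹ = 3 * J := by rw [hV, one_div, inv_inv]
      have hMT : (1 : ℝ) ≤ M * T := one_le_mul_of_one_le_of_one_le hM1r hT
      have hlogle : Real.log (2 * M * T) ^ 4 ≤ Real.log (2 * N₀ * T) ^ 4 := by
        have h0 : 0 ≤ Real.log (2 * M * T) := Real.log_nonneg (by linarith)
        refine pow_le_pow_left₀ h0 (Real.log_le_log (by positivity) ?_) 4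
        have hT0 : 0 ≤ T := by linarith
        nlinarith [mul_le_mul_of_nonneg_right hMN hT0]
      have hLML : LM ≤ L := by
        rw [hLM, hL]
        have := Real.log_le_log (by positivity : (0 : ℝ) < 2 * M) h2M
        linarith
      have hr2 : (M : ℝ) ^ (2 - 2 * σ) ≤ (N₀ : ℝ) ^ (2 - 2 * σ) :=
        Real.rpow_le_rpow hM0.le hMN (by linarith)
      -- first term
      have hA : G * (2 * M) * V⁻¹ ^ 2 ≤ 36 * (J : ℝ) ^ 2 * L ^ 3 * (N₀ : ℝ) ^ (2 - 2 * σ) := by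
        have e1 : (M : ℝ) ^ (1 - 2 * σ) * M = (M : ℝ) ^ (2 - 2 * σ) := by
          rw [show (2 : ℝ) - 2 * σ = (1 - 2 * σ) + 1 by ring, Real.rpow_add hM0, Real.rpow_one]
        calc G * (2 * M) * V⁻¹ ^ 2
            ≤ (2 * (M : ℝ) ^ (1 - 2 * σ) * LM ^ 3) * (2 * M) * V⁻¹ ^ 2 := by gcongr
          _ = 36 * (J : ℝ) ^ 2 * LM ^ 3 * ((M : ℝ) ^ (1 - 2 * σ) * M) := by rw [hVinv]; ring
          _ = 36 * (J : ℝ) ^ 2 * LM ^ 3 * (M : ℝ) ^ (2 - 2 * σ) := by rw [e1]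
          _ ≤ 36 * (J : ℝ) ^ 2 * L ^ 3 * (N₀ : ℝ) ^ (2 - 2 * σ) := by gcongr
      -- second term
      have hB : G ^ 3 * (2 * M) * T * V⁻¹ ^ 6 * Real.log (2 * M * T) ^ 4 ≤
          11664 * (J : ℝ) ^ 6 * T * Real.log (2 * N₀ * T) ^ 4 * L ^ 9 * (X : ℝ) ^ (4 - 6 * σ) := by
        have e3 : ((M : ℝ) ^ (1 - 2 * σ)) ^ 3 * M = (M : ℝ) ^ (4 - 6 * σ) := by
          rw [← Real.rpow_natCast ((M : ℝ) ^ (1 - 2 * σ)), ← Real.rpow_mul hM0.le,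
            show (4 : ℝ) - 6 * σ = (1 - 2 * σ) * ((3 : ℕ) : ℝ) + 1 by push_cast; ring,
            Real.rpow_add hM0, Real.rpow_one]
        have hMX : (M : ℝ) ^ (4 - 6 * σ) ≤ (X : ℝ) ^ (4 - 6 * σ) :=
          Real.rpow_le_rpow_of_nonpos hX0 hXM (by linarith)
        have hLM9 : LM ^ 9 ≤ L ^ 9 := pow_le_pow_left₀ hLM0 hLML 9
        calc G ^ 3 * (2 * M) * T * V⁻¹ ^ 6 * Real.log (2 * M * T) ^ 4
            ≤ (2 * (M : ℝ) ^ (1 - 2 * σ) * LM ^ 3) ^ 3 * (2 * M) * T * V⁻¹ ^ 6 *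
                Real.log (2 * N₀ * T) ^ 4 :=
              mul_le_mul (by gcongr) hlogle (by positivity) (by positivity)
          _ = 11664 * (J : ℝ) ^ 6 * T * Real.log (2 * N₀ * T) ^ 4 * LM ^ 9 *
                (((M : ℝ) ^ (1 - 2 * σ)) ^ 3 * M) := by
              rw [hVinv]; ring
          _ = 11664 * (J : ℝ) ^ 6 * T * Real.log (2 * N₀ * T) ^ 4 * LM ^ 9 *
                (M : ℝ) ^ (4 - 6 * σ) := by rw [e3]
          _ ≤ 11664 * (J : ℝ) ^ 6 * T * Real.log (2 * N₀ * T) ^ 4 * L ^ 9 *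
                (X : ℝ) ^ (4 - 6 * σ) :=
              mul_le_mul (mul_le_mul_of_nonneg_left hLM9 (by positivity)) hMX (by positivity)
                (by positivity)
      calc ((Zi i).card : ℝ) ≤ C_b * (G * (2 * M) * V⁻¹ ^ 2 + G ^ 3 * (2 * M) * T * V⁻¹ ^ 6 *
            Real.log (2 * M * T) ^ 4) := hLV
        _ ≤ R := by rw [hR]; gcongr
  -- sum over the blocks
  calc ((Z.filter (fun ρ ↦ 1 / 3 < ‖∑ n ∈ Finset.Ioc X N₀, c n * (n : ℂ) ^ (-ρ)‖)).card : ℝ)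
      ≤ (((Finset.range J).biUnion Zi).card : ℝ) := by exact_mod_cast Finset.card_le_card hcover
    _ ≤ ∑ i ∈ Finset.range J, ((Zi i).card : ℝ) := by exact_mod_cast Finset.card_biUnion_le
    _ ≤ ∑ i ∈ Finset.range J, R := Finset.sum_le_sum hblock
    _ = J * R := by rw [Finset.sum_const, Finset.card_range, nsmul_eq_mul]

end HuxleyZeroDensity

namespace NearOneLogPower

open HuxleyZeroDensity
open ZeroDetect (mollifier mollCoeff norm_mollCoeff_le)
open HuxleyZeroDetection (smoothed norm_smoothed_le)

/-! ## §2. Absorbing the class-(i) bound: `Φ ≤ K l^{20} T^{2(1−σ)}` -/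

/-- `1 + log(200 l T) ≤ 10 l` for `l = log T ≥ 1`, `T ≥ 1` (`log 200 ≤ 6`, `log l ≤ l − 1`).
[folklore] -/
private theorem one_add_log_le {T l : ℝ} (hT : 1 ≤ T) (hl : Real.log T = l) (hl1 : 1 ≤ l) :
    1 + Real.log (200 * l * T) ≤ 10 * l := by
  have hT0 : 0 < T := by linarith
  have hl0 : 0 < l := by linarith
  have h3 : Real.log (200 * l * T) = Real.log 200 + Real.log l + Real.log T := by
    rw [Real.log_mul (by positivity) hT0.ne', Real.log_mul (by norm_num) hl0.ne']
  have h4 : Real.log l ≤ l := (Real.log_le_sub_one_of_pos hl0).trans (by linarith)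
  rw [h3, hl]
  linarith [log_two_hundred_le]

/-- **Absorption of the class-(i) bound.** With `T ≥ 3`, `l = log T`, `19/20 ≤ σ ≤ 1`,
`1 ≤ N₀ ≤ 100 l T`, `J = log₂ N₀ + 1`, `X ≥ T^{11/20}` and `C_b, c₁, c₂ ≥ 0`:
`J · C_b (c₁ J² (1+log 2N₀)³ N₀^{2−2σ} + c₂ J⁶ T log⁴(2N₀T)(1+log 2N₀)⁹ X^{4−6σ})
≤ C_b (c₁·17³·10³·100 + c₂·17⁷·10¹³) · l²⁰ · T^{2(1−σ)}`: `J ≤ 17 l`, `1 + log 2N₀ ≤ 10 l`,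
`log(2N₀T) ≤ 10 l`, `N₀^{2−2σ} ≤ 100 l T^{2−2σ}`, and `T X^{4−6σ} ≤ T^{1+(11/20)(4−6σ)} ≤ T^{2−2σ}`
because `1 + (11/20)(4−6σ) ≤ 2(1−σ) ⟺ σ ≥ 12/13`. [cite: Huxley1972, Ch. 28, (28.16)–(28.18)] -/
theorem classOne_bound_absorb {C_b c₁ c₂ : ℝ} (hCb : 0 ≤ C_b) (hc₁ : 0 ≤ c₁) (hc₂ : 0 ≤ c₂)
    {σ T : ℝ} (hσ : 19 / 20 ≤ σ) (hσ1 : σ ≤ 1) (hT3 : 3 ≤ T) {X N₀ J : ℕ}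
    (hXge : T ^ (11 / 20 : ℝ) ≤ X) (hN₀1 : 1 ≤ N₀) (hN₀le : (N₀ : ℝ) ≤ 100 * Real.log T * T)
    (hJ : J = Nat.log 2 N₀ + 1) :
    (J : ℝ) * (C_b * (c₁ * (J : ℝ) ^ 2 * (1 + Real.log (2 * N₀)) ^ 3 * (N₀ : ℝ) ^ (2 - 2 * σ) +
        c₂ * (J : ℝ) ^ 6 * T * Real.log (2 * N₀ * T) ^ 4 * (1 + Real.log (2 * N₀)) ^ 9 *
          (X : ℝ) ^ (4 - 6 * σ))) ≤
      C_b * (c₁ * 17 ^ 3 * 10 ^ 3 * 100 + c₂ * 17 ^ 7 * 10 ^ 13) * Real.log T ^ 20 *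
        T ^ (2 * (1 - σ)) := by
  set l : ℝ := Real.log T with hl
  have hT1 : 1 ≤ T := by linarith
  have hT0 : 0 < T := by linarith
  have hl1 : 1 ≤ l := by
    rw [hl, Real.le_log_iff_exp_le hT0]; linarith [Real.exp_one_lt_d9]
  have hl0 : 0 < l := by linarith
  have hN₀pos : (0 : ℝ) < N₀ := by exact_mod_cast hN₀1
  have hN₀1r : (1 : ℝ) ≤ N₀ := by exact_mod_cast hN₀1
  -- `J ≤ 17 l`
  have hlogN₀ : Real.log N₀ ≤ 8 * l := by
    have h1 : (N₀ : ℝ) ≤ 100 * l * T ^ 2 := hN₀le.trans (by nlinarith)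
    have h2 : Real.log N₀ ≤ Real.log (100 * l * T ^ 2) := Real.log_le_log hN₀pos h1
    have h3 : Real.log (100 * l * T ^ 2) = Real.log 100 + Real.log l + 2 * Real.log T := by
      rw [Real.log_mul (by positivity) (by positivity), Real.log_mul (by norm_num) (by positivity),
        Real.log_pow]; push_cast; ring
    have h4 : Real.log l ≤ l := (Real.log_le_sub_one_of_pos hl0).trans (by linarith)
    rw [h3, ← hl] at h2
    linarith [log_hundred_le]
  have hJ17 : (J : ℝ) ≤ 17 * l := by
    have h1 : (J : ℝ) = Nat.log 2 N₀ + 1 := by rw [hJ]; push_cast; ring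
    rw [h1]
    have h2 := natLog_two_le N₀ hN₀1
    linarith
  have hJ0 : (0 : ℝ) ≤ J := Nat.cast_nonneg J
  -- `1 + log 2N₀ ≤ 10 l`, `log (2 N₀ T) ≤ 10 l`
  have h2N₀ : 2 * (N₀ : ℝ) ≤ 200 * l * T := by linarith
  have hL₁ : 1 + Real.log (2 * (N₀ : ℝ)) ≤ 10 * l := by
    have h1 : Real.log (2 * (N₀ : ℝ)) ≤ Real.log (200 * l * T) :=
      Real.log_le_log (by positivity) h2N₀
    have h2 := one_add_log_le hT1 hl.symm hl1
    linarith
  have hL₁0 : 0 ≤ 1 + Real.log (2 * (N₀ : ℝ)) := by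
    have : 0 ≤ Real.log (2 * (N₀ : ℝ)) := Real.log_nonneg (by linarith)
    linarith
  have hL₂ : Real.log (2 * (N₀ : ℝ) * T) ≤ 10 * l := by
    have h1 : 2 * (N₀ : ℝ) * T ≤ 200 * l * T ^ 2 := by nlinarith
    have h2 : Real.log (2 * (N₀ : ℝ) * T) ≤ Real.log (200 * l * T ^ 2) :=
      Real.log_le_log (by positivity) h1
    have h3 : Real.log (200 * l * T ^ 2) = Real.log 200 + Real.log l + 2 * Real.log T := by
      rw [Real.log_mul (by positivity) (by positivity), Real.log_mul (by norm_num) (by positivity),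
        Real.log_pow]; push_cast; ring
    have h4 : Real.log l ≤ l := (Real.log_le_sub_one_of_pos hl0).trans (by linarith)
    rw [h3, ← hl] at h2
    linarith [log_two_hundred_le]
  have hL₂0 : 0 ≤ Real.log (2 * (N₀ : ℝ) * T) :=
    Real.log_nonneg (by nlinarith)
  -- `N₀^{2−2σ} ≤ 100 l T^{2−2σ}`
  have h100l : (1 : ℝ) ≤ 100 * l := by linarith
  have hA3 : (N₀ : ℝ) ^ (2 - 2 * σ) ≤ 100 * l * T ^ (2 * (1 - σ)) := by
    calc (N₀ : ℝ) ^ (2 - 2 * σ) ≤ (100 * l * T) ^ (2 - 2 * σ) :=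
          Real.rpow_le_rpow hN₀pos.le hN₀le (by linarith)
      _ = (100 * l) ^ (2 - 2 * σ) * T ^ (2 - 2 * σ) := Real.mul_rpow (by positivity) hT0.le
      _ ≤ (100 * l) * T ^ (2 * (1 - σ)) := by
          rw [show 2 * (1 - σ) = 2 - 2 * σ by ring]
          exact mul_le_mul_of_nonneg_right (Real.rpow_le_self_of_one_le h100l (by linarith))
            (by positivity)
  -- `T X^{4−6σ} ≤ T^{2(1−σ)}`
  have hTx : 0 < T ^ (11 / 20 : ℝ) := by positivity
  have hXpos : (0 : ℝ) < X := lt_of_lt_of_le hTx hXge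
  have hA5 : T * (X : ℝ) ^ (4 - 6 * σ) ≤ T ^ (2 * (1 - σ)) := by
    have h1 : (X : ℝ) ^ (4 - 6 * σ) ≤ (T ^ (11 / 20 : ℝ)) ^ (4 - 6 * σ) :=
      Real.rpow_le_rpow_of_nonpos hTx hXge (by linarith)
    have h2 : (T ^ (11 / 20 : ℝ)) ^ (4 - 6 * σ) = T ^ (11 / 20 * (4 - 6 * σ)) := by
      rw [← Real.rpow_mul hT0.le]
    have h3 : T * T ^ (11 / 20 * (4 - 6 * σ)) = T ^ (1 + 11 / 20 * (4 - 6 * σ)) := by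
      rw [Real.rpow_add hT0, Real.rpow_one]
    have h4 : 1 + 11 / 20 * (4 - 6 * σ) ≤ 2 * (1 - σ) := by nlinarith
    calc T * (X : ℝ) ^ (4 - 6 * σ) ≤ T * (T ^ (11 / 20 : ℝ)) ^ (4 - 6 * σ) :=
          mul_le_mul_of_nonneg_left h1 hT0.le
      _ = T ^ (1 + 11 / 20 * (4 - 6 * σ)) := by rw [h2, h3]
      _ ≤ T ^ (2 * (1 - σ)) := Real.rpow_le_rpow_of_exponent_le hT1 h4
  -- assemble
  have hTκ : 0 ≤ T ^ (2 * (1 - σ)) := by positivity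
  -- first term
  have hterm1 : c₁ * (J : ℝ) ^ 2 * (1 + Real.log (2 * (N₀ : ℝ))) ^ 3 * (N₀ : ℝ) ^ (2 - 2 * σ)
      ≤ c₁ * 17 ^ 2 * 10 ^ 3 * 100 * l ^ 6 * T ^ (2 * (1 - σ)) := by
    have h1 : (J : ℝ) ^ 2 ≤ (17 * l) ^ 2 := pow_le_pow_left₀ hJ0 hJ17 2
    have h2 : (1 + Real.log (2 * (N₀ : ℝ))) ^ 3 ≤ (10 * l) ^ 3 := pow_le_pow_left₀ hL₁0 hL₁ 3
    calc c₁ * (J : ℝ) ^ 2 * (1 + Real.log (2 * (N₀ : ℝ))) ^ 3 * (N₀ : ℝ) ^ (2 - 2 * σ)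
        ≤ c₁ * (17 * l) ^ 2 * (10 * l) ^ 3 * (100 * l * T ^ (2 * (1 - σ))) := by
          apply mul_le_mul (mul_le_mul (mul_le_mul_of_nonneg_left h1 hc₁) h2 (by positivity)
            (by positivity)) hA3 (by positivity) (by positivity)
      _ = c₁ * 17 ^ 2 * 10 ^ 3 * 100 * l ^ 6 * T ^ (2 * (1 - σ)) := by ring
  -- second term
  have hterm2 : c₂ * (J : ℝ) ^ 6 * T * Real.log (2 * (N₀ : ℝ) * T) ^ 4 *
      (1 + Real.log (2 * (N₀ : ℝ))) ^ 9 * (X : ℝ) ^ (4 - 6 * σ)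
      ≤ c₂ * 17 ^ 6 * 10 ^ 4 * 10 ^ 9 * l ^ 19 * T ^ (2 * (1 - σ)) := by
    have h1 : (J : ℝ) ^ 6 ≤ (17 * l) ^ 6 := pow_le_pow_left₀ hJ0 hJ17 6
    have h2 : Real.log (2 * (N₀ : ℝ) * T) ^ 4 ≤ (10 * l) ^ 4 := pow_le_pow_left₀ hL₂0 hL₂ 4
    have h3 : (1 + Real.log (2 * (N₀ : ℝ))) ^ 9 ≤ (10 * l) ^ 9 := pow_le_pow_left₀ hL₁0 hL₁ 9
    have e : c₂ * (J : ℝ) ^ 6 * T * Real.log (2 * (N₀ : ℝ) * T) ^ 4 *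
        (1 + Real.log (2 * (N₀ : ℝ))) ^ 9 * (X : ℝ) ^ (4 - 6 * σ)
        = c₂ * ((J : ℝ) ^ 6 * (Real.log (2 * (N₀ : ℝ) * T) ^ 4 *
          (1 + Real.log (2 * (N₀ : ℝ))) ^ 9)) * (T * (X : ℝ) ^ (4 - 6 * σ)) := by ring
    rw [e]
    calc c₂ * ((J : ℝ) ^ 6 * (Real.log (2 * (N₀ : ℝ) * T) ^ 4 * (1 + Real.log (2 * (N₀ : ℝ))) ^ 9))
          * (T * (X : ℝ) ^ (4 - 6 * σ))
        ≤ c₂ * ((17 * l) ^ 6 * ((10 * l) ^ 4 * (10 * l) ^ 9)) * T ^ (2 * (1 - σ)) := by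
          apply mul_le_mul (mul_le_mul_of_nonneg_left (mul_le_mul h1 (mul_le_mul h2 h3
            (by positivity) (by positivity)) (by positivity) (by positivity)) hc₂) hA5
            (by positivity) (by positivity)
      _ = c₂ * 17 ^ 6 * 10 ^ 4 * 10 ^ 9 * l ^ 19 * T ^ (2 * (1 - σ)) := by ring
  -- total
  have hsum : C_b * (c₁ * (J : ℝ) ^ 2 * (1 + Real.log (2 * (N₀ : ℝ))) ^ 3 * (N₀ : ℝ) ^ (2 - 2 * σ) +
      c₂ * (J : ℝ) ^ 6 * T * Real.log (2 * (N₀ : ℝ) * T) ^ 4 *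
      (1 + Real.log (2 * (N₀ : ℝ))) ^ 9 * (X : ℝ) ^ (4 - 6 * σ))
      ≤ C_b * ((c₁ * 17 ^ 2 * 10 ^ 3 * 100 + c₂ * 17 ^ 6 * 10 ^ 4 * 10 ^ 9) * l ^ 19 *
        T ^ (2 * (1 - σ))) := by
    apply mul_le_mul_of_nonneg_left _ hCb
    have hl6 : l ^ 6 ≤ l ^ 19 := pow_le_pow_right₀ hl1 (by norm_num)
    have h1 : c₁ * 17 ^ 2 * 10 ^ 3 * 100 * l ^ 6 * T ^ (2 * (1 - σ))
        ≤ c₁ * 17 ^ 2 * 10 ^ 3 * 100 * l ^ 19 * T ^ (2 * (1 - σ)) := by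
      apply mul_le_mul_of_nonneg_right (mul_le_mul_of_nonneg_left hl6 (by positivity)) hTκ
    nlinarith [hterm1, hterm2, h1]
  calc (J : ℝ) * (C_b * (c₁ * (J : ℝ) ^ 2 * (1 + Real.log (2 * (N₀ : ℝ))) ^ 3 *
        (N₀ : ℝ) ^ (2 - 2 * σ) + c₂ * (J : ℝ) ^ 6 * T * Real.log (2 * (N₀ : ℝ) * T) ^ 4 *
        (1 + Real.log (2 * (N₀ : ℝ))) ^ 9 * (X : ℝ) ^ (4 - 6 * σ)))
      ≤ (17 * l) * (C_b * ((c₁ * 17 ^ 2 * 10 ^ 3 * 100 + c₂ * 17 ^ 6 * 10 ^ 4 * 10 ^ 9) * l ^ 19 *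
        T ^ (2 * (1 - σ)))) := mul_le_mul hJ17 hsum (by positivity) (by positivity)
    _ = C_b * (c₁ * 17 ^ 3 * 10 ^ 3 * 100 + c₂ * 17 ^ 7 * 10 ^ 13) * l ^ 20 * T ^ (2 * (1 - σ)) := by
        ring

/-! ## §3. The count of a `300 log T`-separated set of zeros in a dyadic block -/

/-- **The raw count of a block** (Huxley (28.5)–(28.16) with the class (ii) EMPTY and no `T^ε`).
There are `U₀ ≥ 3` and `K ≥ 0` such that for all `U ≥ U₀`, `19/20 ≤ σ ≤ 1` and every finite set
`Z` of zeros `ρ = β + iγ` of `ζ` with `β ≥ σ`, `U < γ ≤ 2U` and ordinates pairwise `≥ 300 log 2U`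
apart, `|Z| ≤ K (log 2U)^{20} (2U)^{2(1−σ)}`: with `T = 2U`, `X = ⌈T^{11/20}⌉`, `Y = T` every
`ρ ∈ Z` is of class (i) (`classOne_of_zero`: zero detection `HuxleyZeroDensity.zeroDetection_integral`
at `δ = 9/20` and Weyl's bound), the class (i) zeros are counted by
`HuxleyZeroDensity.classOne_card_le_log`
(`N₀ = ⌊100 l T⌋`, `J = log₂ N₀ + 1`, separation `log 2N₀ ≤ 10 l ≤ 300 l`), and the bound is
absorbed by `classOne_bound_absorb`. [cite: Huxley1972, Ch. 28, (28.5)–(28.18)] -/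
theorem card_block_sep_le :
    ∃ U₀ K : ℝ, 3 ≤ U₀ ∧ 0 ≤ K ∧ ∀ U : ℝ, U₀ ≤ U → ∀ σ : ℝ, 19 / 20 ≤ σ → σ ≤ 1 →
      ∀ Z : Finset ℂ, (∀ ρ ∈ Z, riemannZeta ρ = 0 ∧ σ ≤ ρ.re ∧ U < ρ.im ∧ ρ.im ≤ 2 * U) →
      (∀ ρ ∈ Z, ∀ ρ' ∈ Z, ρ ≠ ρ' → 300 * Real.log (2 * U) ≤ |ρ.im - ρ'.im|) →
      (Z.card : ℝ) ≤ K * Real.log (2 * U) ^ 20 * (2 * U) ^ (2 * (1 - σ)) := by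
  classical
  obtain ⟨C_b, hCb0, hCb⟩ := exists_block_largeValues_const
  obtain ⟨T₁, hT₁⟩ := classOne_of_zero
  refine ⟨max 3 T₁, C_b * (36 * 17 ^ 3 * 10 ^ 3 * 100 + 11664 * 17 ^ 7 * 10 ^ 13), le_max_left _ _,
    by positivity, fun U hU σ hσ hσ1 Z hZ hsep ↦ ?_⟩
  have hU3 : 3 ≤ U := le_trans (le_max_left _ _) hU
  have hUT₁ : T₁ ≤ U := le_trans (le_max_right _ _) hU
  set T : ℝ := 2 * U with hT
  have hT3 : 3 ≤ T := by linarith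
  have hT1 : 1 ≤ T := by linarith
  have hT0 : 0 < T := by linarith
  have hTT₁ : T₁ ≤ T := by linarith
  have hl1 : 1 ≤ Real.log T := by
    rw [Real.le_log_iff_exp_le hT0]; linarith [Real.exp_one_lt_d9]
  have hl0 : 0 ≤ Real.log T := by linarith
  -- the parameters `X = ⌈T^{11/20}⌉`, `N₀ = ⌊100 l T⌋`, `J = log₂ N₀ + 1`
  set X : ℕ := ⌈T ^ (11 / 20 : ℝ)⌉₊ with hX
  set N₀ : ℕ := ⌊100 * Real.log T * T⌋₊ with hN₀
  set J : ℕ := Nat.log 2 N₀ + 1 with hJ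
  have hTx0 : 0 < T ^ (11 / 20 : ℝ) := by positivity
  have hTx1 : 1 ≤ T ^ (11 / 20 : ℝ) := Real.one_le_rpow hT1 (by norm_num)
  have hX1 : 1 ≤ X := Nat.one_le_ceil_iff.2 hTx0
  have hXge : T ^ (11 / 20 : ℝ) ≤ X := Nat.le_ceil _
  have hX2 : (X : ℝ) ≤ 2 * T ^ (11 / 20 : ℝ) := by
    have := Nat.ceil_lt_add_one hTx0.le
    linarith
  have hlT : 1 ≤ Real.log T * T := by nlinarith
  have hN₀le : (N₀ : ℝ) ≤ 100 * Real.log T * T := Nat.floor_le (by positivity)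
  have hN₀1 : 1 ≤ N₀ := by
    rw [hN₀, Nat.one_le_floor_iff]; linarith
  have hN₀pos : (0 : ℝ) < N₀ := by exact_mod_cast hN₀1
  have hN₀J : N₀ < 2 ^ J := Nat.lt_pow_succ_log_self (by norm_num) N₀
  -- the coefficients `a_X(n) e^{-n/T}` are divisor-bounded
  have hc : ∀ n, ‖smoothed (mollCoeff X) T n‖ ≤ (n.divisors.card : ℝ) :=
    fun n ↦ (norm_smoothed_le _ hT0 n).trans (norm_mollCoeff_le X n)
  -- every zero of the block is of class (i)
  have hclass : ∀ ρ ∈ Z, 1 / 3 < ‖∑ n ∈ Finset.Ioc X N₀,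
      smoothed (mollCoeff X) T n * (n : ℂ) ^ (-ρ)‖ := by
    intro ρ hρ
    obtain ⟨hζ, hβ, hγ1, hγ2⟩ := hZ ρ hρ
    exact hT₁ T hTT₁ X hX1 hX2 ρ hζ (by linarith) (by linarith) hγ2
  have hfilter : Z.filter (fun ρ ↦ 1 / 3 < ‖∑ n ∈ Finset.Ioc X N₀,
      smoothed (mollCoeff X) T n * (n : ℂ) ^ (-ρ)‖) = Z := Finset.filter_true_of_mem hclass
  -- separation: `log 2N₀ ≤ 10 l ≤ 300 l ≤ |γ − γ'| < U ≤ T`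
  have hlog2N₀ : Real.log (2 * (N₀ : ℝ)) ≤ 300 * Real.log T := by
    have h1 : Real.log (2 * (N₀ : ℝ)) ≤ Real.log (200 * Real.log T * T) :=
      Real.log_le_log (by positivity) (by linarith)
    have h2 := one_add_log_le hT1 rfl hl1
    linarith
  have hsep' : ∀ ρ ∈ Z, ∀ ρ' ∈ Z, ρ ≠ ρ' →
      Real.log (2 * N₀) ≤ |ρ.im - ρ'.im| ∧ |ρ.im - ρ'.im| ≤ T := by
    intro ρ hρ ρ' hρ' hne
    refine ⟨hlog2N₀.trans (hsep ρ hρ ρ' hρ' hne), ?_⟩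
    obtain ⟨-, -, h1, h2⟩ := hZ ρ hρ
    obtain ⟨-, -, h1', h2'⟩ := hZ ρ' hρ'
    rw [abs_le]; constructor <;> linarith
  have hre : ∀ ρ ∈ Z, σ ≤ ρ.re ∧ ρ.re < 1 :=
    fun ρ hρ ↦ ⟨(hZ ρ hρ).2.1, re_lt_one_of_riemannZeta_eq_zero (hZ ρ hρ).1⟩
  have hcount := HuxleyZeroDensity.classOne_card_le_log hCb0 hCb hc (by linarith) hσ1 hT1 hX1 hN₀1
    hN₀J Z hre hsep'
  rw [hfilter] at hcount
  have habs := classOne_bound_absorb hCb0 (by norm_num : (0 : ℝ) ≤ 36)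
    (by norm_num : (0 : ℝ) ≤ 11664) hσ hσ1 hT3 hXge hN₀1 hN₀le hJ
  exact hcount.trans habs

/-! ## §4. The well-spaced count: thinning into `300 log T`-separated classes -/

/-- **The well-spaced count, log-power form** (Huxley (28.19) at `Y = T`, `X = T^{11/20}`, class
(ii) empty): there are `U₀ ≥ 1` and `A ≥ 0` such that for all `U ≥ U₀`, `19/20 ≤ σ < 1` and every
finite set `Z` of zeros of `ζ` with `β ≥ σ`, `U < γ ≤ 2U` and ordinates pairwise `≥ 1` apart,
`|Z| ≤ A U^{2(1−σ)} (log U)^{21}`: thin `Z` into `⌈300 l⌉ + 1` classes by `⌊γ⌋ mod (⌈300 l⌉ + 1)`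
(`HuxleyZeroDensity.card_le_of_thinning`), each class `≥ 300 l` separated and counted by
`card_block_sep_le`; `(⌈300 l⌉ + 1) K l^{20} T^{2(1−σ)} ≤ 302 K l^{21} T^{2(1−σ)}` and `T = 2U`,
`l ≤ 2 log U`, `T^{2(1−σ)} ≤ 2 U^{2(1−σ)}`. [cite: Huxley1972, Ch. 28, (28.1), (28.19)] -/
theorem wellSpaced_logPower :
    ∃ U₀ A : ℝ, 1 ≤ U₀ ∧ 0 ≤ A ∧ ∀ U : ℝ, U₀ ≤ U → ∀ σ : ℝ, 19 / 20 ≤ σ → σ < 1 →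
      ∀ Z : Finset ℂ, (∀ ρ ∈ Z, riemannZeta ρ = 0 ∧ σ ≤ ρ.re ∧ U < ρ.im ∧ ρ.im ≤ 2 * U) →
      (∀ ρ ∈ Z, ∀ ρ' ∈ Z, ρ ≠ ρ' → 1 ≤ |ρ.im - ρ'.im|) →
      (Z.card : ℝ) ≤ A * U ^ (2 * (1 - σ)) * Real.log U ^ (21 : ℝ) := by
  classical
  obtain ⟨U₀, K, hU₀, hK, hblock⟩ := card_block_sep_le
  refine ⟨U₀, 302 * 2 ^ 22 * K, by linarith, by positivity, fun U hU σ hσ hσ1 Z hZ hsep ↦ ?_⟩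
  have hU3 : 3 ≤ U := hU₀.trans hU
  have hU0 : 0 < U := by linarith
  set T : ℝ := 2 * U with hT
  have hT0 : 0 < T := by linarith
  have hT1 : 1 ≤ T := by linarith
  set l : ℝ := Real.log T with hl
  have hl1 : 1 ≤ l := by
    rw [hl, Real.le_log_iff_exp_le hT0]; linarith [Real.exp_one_lt_d9]
  have hl0 : 0 ≤ l := by linarith
  -- thinning into `k = ⌈300 l⌉ + 1` classes
  set k : ℕ := ⌈300 * l⌉₊ + 1 with hk
  have hk1 : 1 ≤ k := by omega
  have hkl : (k : ℝ) - 1 = ⌈300 * l⌉₊ := by rw [hk]; push_cast; ring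
  have hkle : (k : ℝ) ≤ 300 * l + 2 := by
    have := Nat.ceil_lt_add_one (by positivity : (0 : ℝ) ≤ 300 * l)
    rw [hk]; push_cast; linarith
  have hpos : ∀ ρ ∈ Z, 0 ≤ ρ.im := fun ρ hρ ↦ by linarith [(hZ ρ hρ).2.2.1]
  set Bd : ℝ := K * l ^ 20 * T ^ (2 * (1 - σ)) with hBd
  have hBd0 : 0 ≤ Bd := by positivity
  have hthin : ∀ Z' ⊆ Z, (∀ ρ ∈ Z', ∀ ρ' ∈ Z', ρ ≠ ρ' → (k : ℝ) - 1 ≤ |ρ.im - ρ'.im|) →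
      (Z'.card : ℝ) ≤ Bd := by
    intro Z' hZ' hsep'
    have hZ'' : ∀ ρ ∈ Z', riemannZeta ρ = 0 ∧ σ ≤ ρ.re ∧ U < ρ.im ∧ ρ.im ≤ 2 * U :=
      fun ρ hρ ↦ hZ ρ (hZ' hρ)
    have hsep'' : ∀ ρ ∈ Z', ∀ ρ' ∈ Z', ρ ≠ ρ' → 300 * Real.log (2 * U) ≤ |ρ.im - ρ'.im| := by
      intro ρ hρ ρ' hρ' hne
      have h := hsep' ρ hρ ρ' hρ' hne
      rw [hkl] at h
      exact le_trans (Nat.le_ceil _) h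
    exact hblock U hU σ hσ hσ1.le Z' hZ'' hsep''
  have hcard := card_le_of_thinning Z hk1 hpos hsep hthin
  -- `k Bd ≤ 302 K l^21 T^{2(1−σ)} ≤ 302·2^22 K U^{2(1−σ)} (log U)^21`
  have hκ1 : 2 * (1 - σ) ≤ 1 := by linarith
  have hκ0 : 0 ≤ 2 * (1 - σ) := by linarith
  have hTU : T ^ (2 * (1 - σ)) ≤ 2 * U ^ (2 * (1 - σ)) := by
    rw [hT, Real.mul_rpow (by norm_num) hU0.le]
    apply mul_le_mul_of_nonneg_right _ (by positivity)
    calc (2 : ℝ) ^ (2 * (1 - σ)) ≤ 2 ^ (1 : ℝ) :=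
          Real.rpow_le_rpow_of_exponent_le (by norm_num) hκ1
      _ = 2 := Real.rpow_one 2
  have hlogU2 : Real.log 2 ≤ Real.log U := Real.log_le_log (by norm_num) (by linarith)
  have hlogU0 : 0 ≤ Real.log U := le_trans (Real.log_nonneg (by norm_num)) hlogU2
  have hlU : l ≤ 2 * Real.log U := by
    rw [hl, hT, Real.log_mul (by norm_num) hU0.ne']
    linarith
  have hl21 : l ^ 21 ≤ 2 ^ 21 * Real.log U ^ 21 := by
    calc l ^ 21 ≤ (2 * Real.log U) ^ 21 := pow_le_pow_left₀ hl0 hlU 21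
      _ = 2 ^ 21 * Real.log U ^ 21 := by ring
  have hrpow : Real.log U ^ (21 : ℝ) = Real.log U ^ 21 := by
    rw [show (21 : ℝ) = ((21 : ℕ) : ℝ) by norm_num, Real.rpow_natCast]
  rw [hrpow]
  calc (Z.card : ℝ) ≤ k * Bd := hcard
    _ ≤ (300 * l + 2) * Bd := mul_le_mul_of_nonneg_right hkle hBd0
    _ ≤ (302 * l) * Bd := mul_le_mul_of_nonneg_right (by linarith) hBd0
    _ = 302 * K * l ^ 21 * T ^ (2 * (1 - σ)) := by rw [hBd]; ring
    _ ≤ 302 * K * (2 ^ 21 * Real.log U ^ 21) * (2 * U ^ (2 * (1 - σ))) :=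
        mul_le_mul (mul_le_mul_of_nonneg_left hl21 (by positivity)) hTU (by positivity)
          (by positivity)
    _ = 302 * 2 ^ 22 * K * U ^ (2 * (1 - σ)) * Real.log U ^ 21 := by ring

end NearOneLogPower

/-! ## §5. The log-power density theorem near `σ = 1` and the discharge of (13.3) -/

/-- **Zero density near `σ = 1` with logarithmic losses only** (density-hypothesis strength):
there are `C > 0`, `B`, `T₀` with `N(σ, T) ≤ C T^{2(1−σ)} (log T)^B` for all `T ≥ T₀` and
`19/20 ≤ σ ≤ 1` (here `C = 1`, `B = 24`). Ingham–Huxley zero detection at `Re s = 1/2` with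
`X = T^{11/20}`, `Y = T`: no class (ii) zeros by Weyl's bound (`NearOneLogPower.classOne_of_zero`),
class (i) counted by Huxley's large-values theorem with the mean-square divisor bound
(`HuxleyZeroDensity.classOne_card_le_log`), thinning, and the σ-uniform window/dyadic layer
`ZeroDensity.zetaZeroCountRe_le_of_wellSpaced_uniform`; `σ = 1`: no zeros
(`zetaZeroCountRe_eq_zero_of_one_le`). Huxley's (28.19) `N(σ,T) ≪ T^{…}(log T)^{B}` specialised to
the range `σ ≥ 19/20` where the fourth-moment/class-(ii) terms are absent.
[cite: Huxley1972, Ch. 28, (28.19)] [cite: Ivic1985, Thm. 11.1, proof of (11.23)] -/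
theorem zetaZeroCountRe_le_nearOne_logPower :
    ∃ C B T₀ : ℝ, 0 < C ∧ ∀ T : ℝ, T₀ ≤ T → ∀ σ : ℝ, 19 / 20 ≤ σ → σ ≤ 1 →
      (zetaZeroCountRe σ T : ℝ) ≤ C * T ^ (2 * (1 - σ)) * Real.log T ^ B := by
  obtain ⟨U₀, A, hU₀, hA, hmid⟩ := NearOneLogPower.wellSpaced_logPower
  obtain ⟨T₀, hT₀1, h⟩ := ZeroDensity.zetaZeroCountRe_le_of_wellSpaced_uniform (σ₁ := 19 / 20)
    (e := fun σ : ℝ ↦ 2 * (1 - σ)) (C' := 21) (by norm_num) hA (by norm_num) hU₀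
    (fun σ _ hσ1 ↦ by linarith) hmid
  refine ⟨1, 24, T₀, one_pos, fun T hT σ hσ hσ1 ↦ ?_⟩
  have hT1 : 1 ≤ T := hT₀1.trans hT
  have hlog : 0 ≤ Real.log T := Real.log_nonneg hT1
  rcases hσ1.lt_or_eq with hlt | heq
  · have h' := h T hT σ hσ hlt
    have e24 : (21 : ℝ) + 3 = 24 := by norm_num
    rw [e24] at h'
    rw [one_mul]
    exact h'
  · rw [heq, zetaZeroCountRe_eq_zero_of_one_le le_rfl, Nat.cast_zero]
    have : 0 ≤ Real.log T ^ (24 : ℝ) := Real.rpow_nonneg hlog _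
    positivity

/-- **Discharge of `GuthMaynard2026_eq_13_3`** (Guth–Maynard (13.3), the combined density bound
`N(σ,T) ≪ T^{(30/13+o(1))(1−σ)}(log T)^{O(1)}` on `1/2 ≤ σ ≤ 1`): the near-one log-power bound
`zetaZeroCountRe_le_nearOne_logPower` (`A₀ = 2 < 30/13` on `[19/20, 1]`) spliced with the tree's
uniform `30/13` theorem `zetaZeroCountRe_le_thirty_thirteenths_uniform` on `[1/2, 19/20]`
(`GuthMaynard2026_eq_13_3_of_nearOne`). Net debt 0: the fact lands with its proof.
[cite: GuthMaynard2026, §13.2 display (13.3) (arXiv v2 p. 50 = v1 chunk p0029:L16)] -/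
theorem GuthMaynard2026_eq_13_3_holds : GuthMaynard2026_eq_13_3 := by
  obtain ⟨C, B, T₀, -, h⟩ := zetaZeroCountRe_le_nearOne_logPower
  exact GuthMaynard2026_eq_13_3_of_nearOne (A₀ := 2) (δ₁ := 1 / 20) (C₂ := C) (B := B) (T₂ := T₀)
    (by norm_num) (by norm_num) (by norm_num)
    (fun T hT σ hσ hσ1 ↦ h T hT σ (by linarith) hσ1)

/-! ## §6. Corollaries 1.3 and 1.4 UNCONDITIONAL: the closing compositions — block authored by rh-crit-gm-t9 g1

This section is the body of `gm/scratch-t9/GuthMaynardPrimeCorollariesHolds_FINAL.lean`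
(sha16 `59c5726e19caf460`, seat rh-crit-gm-t9 g1), pasted verbatim per the cell lead's ruling A2' (7)
(zero olean hops: the display (13.3) and the four interface facts of `GuthMaynardPrimeCorollaries.lean`
are discharged in ONE proposal). The printed proof of Corollaries 1.3 and 1.4 (GM §13.2) uses the
zero-density input only through (13.3); the step files `GuthMaynardPsiShortIntervalsProofs.lean`
(§13.2 (a)–(c)), `GuthMaynardPrimesShortIntervalsProofs.lean` (ψ → π),
`GuthMaynardPsiMeanSquareProofs.lean` (§13.2 (d)) and `GuthMaynardPrimesAlmostAllProofs.lean`
(Chebyshev step) are composed here with `GuthMaynard2026_eq_13_3_holds`: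
`combinedDensity_pos_of_combinedDensity` (adapter `hcomb ⇒ hcomb ∧ 0 < C`),
`GuthMaynard2026_{psiMeanSquareShort,corollary_1_3,corollary_1_4}_of_combinedDensity`,
`…_of_nearOne`, `…_of_Ivic1985_theorem11_3`, and the UNCONDITIONAL
`GuthMaynard2026_psiShortIntervals_holds`, `GuthMaynard2026_psiMeanSquareShort_holds`,
`GuthMaynard2026_corollary_1_3_holds`, `GuthMaynard2026_corollary_1_4_holds`,
`GuthMaynard2026_exists_prime_mem_Ioc`, `GuthMaynard2026_primeGap_le_rpow`. NOT RH-BEARING: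
theorems about primes in (almost all) short intervals; nothing here bears on the truth of RH. -/

/-- Adapter: the combined density bound (13.3) with an arbitrary constant implies the same bound with
a positive constant and a threshold `T₀ ≥ 1` (replace `C` by `max C 1`; for `T ≥ 1` the factor
`T^{a} (log T)^B` is non-negative). [cite: GuthMaynard2026, §13.2, display (13.3)] -/
theorem combinedDensity_pos_of_combinedDensity
    (hcomb : ∀ η : ℝ, 0 < η → ∃ C B T₀ : ℝ, ∀ T : ℝ, T₀ ≤ T → ∀ σ : ℝ, 1 / 2 ≤ σ → σ ≤ 1 →
      (zetaZeroCountRe σ T : ℝ) ≤ C * T ^ ((30 / 13 + η) * (1 - σ)) * Real.log T ^ B) :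
    ∀ η : ℝ, 0 < η → ∃ C B T₀ : ℝ, 0 < C ∧ ∀ T : ℝ, T₀ ≤ T → ∀ σ : ℝ, 1 / 2 ≤ σ → σ ≤ 1 →
      (zetaZeroCountRe σ T : ℝ) ≤ C * T ^ ((30 / 13 + η) * (1 - σ)) * Real.log T ^ B := by
  intro η hη
  obtain ⟨C, B, T₀, h⟩ := hcomb η hη
  refine ⟨max C 1, B, max T₀ 1, lt_of_lt_of_le one_pos (le_max_right _ _), fun T hT σ hσ hσ1 => ?_⟩
  have hT1 : 1 ≤ T := (le_max_right _ _).trans hT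
  have hP : 0 ≤ T ^ ((30 / 13 + η) * (1 - σ)) * Real.log T ^ B :=
    mul_nonneg (Real.rpow_nonneg (by linarith) _) (Real.rpow_nonneg (Real.log_nonneg hT1) _)
  calc (zetaZeroCountRe σ T : ℝ) ≤ C * T ^ ((30 / 13 + η) * (1 - σ)) * Real.log T ^ B :=
        h T ((le_max_left _ _).trans hT) σ hσ hσ1
    _ = C * (T ^ ((30 / 13 + η) * (1 - σ)) * Real.log T ^ B) := by ring
    _ ≤ max C 1 * (T ^ ((30 / 13 + η) * (1 - σ)) * Real.log T ^ B) :=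
        mul_le_mul_of_nonneg_right (le_max_left _ _) hP
    _ = max C 1 * T ^ ((30 / 13 + η) * (1 - σ)) * Real.log T ^ B := by ring

/-- **The mean square (AlmostAllTarget) from (13.3) alone**: `GuthMaynard2026_psiMeanSquareShort`
from the combined density bound, via `GuthMaynardPsiMeanSquare.psiMeanSquareShort_of_combinedDensity`
(which discharges the explicit formula, the `30/13` theorem being part of the hypothesis and the
Vinogradov–Korobov region a tree theorem). [cite: GuthMaynard2026, §13.2 (proof of Corollary 1.4)] -/
theorem GuthMaynard2026_psiMeanSquareShort_of_combinedDensity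
    (hcomb : ∀ η : ℝ, 0 < η → ∃ C B T₀ : ℝ, ∀ T : ℝ, T₀ ≤ T → ∀ σ : ℝ, 1 / 2 ≤ σ → σ ≤ 1 →
      (zetaZeroCountRe σ T : ℝ) ≤ C * T ^ ((30 / 13 + η) * (1 - σ)) * Real.log T ^ B) :
    GuthMaynard2026_psiMeanSquareShort :=
  fun ε hε A ↦ GuthMaynardPsiMeanSquare.psiMeanSquareShort_of_combinedDensity
    (combinedDensity_pos_of_combinedDensity hcomb) ε hε A

/-- **Corollary 1.3 from (13.3) alone**: primes in all short intervals `[x, x + x^{17/30+ε}]`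
(`GuthMaynard2026_corollary_1_3`) from the combined density bound, composing
`psiShortIntervals_of_combinedDensity` (§13.2 (a)–(c)) with the partial-summation step
`GuthMaynard2026_corollary_1_3_of_psiShortIntervals`. NOT RH-BEARING.
[cite: GuthMaynard2026, Corollary 1.3 and §13.2] -/
theorem GuthMaynard2026_corollary_1_3_of_combinedDensity
    (hcomb : ∀ η : ℝ, 0 < η → ∃ C B T₀ : ℝ, ∀ T : ℝ, T₀ ≤ T → ∀ σ : ℝ, 1 / 2 ≤ σ → σ ≤ 1 →
      (zetaZeroCountRe σ T : ℝ) ≤ C * T ^ ((30 / 13 + η) * (1 - σ)) * Real.log T ^ B) :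
    GuthMaynard2026_corollary_1_3 :=
  GuthMaynard2026_corollary_1_3_of_psiShortIntervals (psiShortIntervals_of_combinedDensity hcomb)

/-- **Corollary 1.4 from (13.3) alone**: primes in almost all short intervals `[x, x + x^{2/15+ε}]`
(`GuthMaynard2026_corollary_1_4`) from the combined density bound, composing the mean square with
the Chebyshev/Cauchy–Schwarz step `GuthMaynard2026_corollary_1_4_of_psiMeanSquareShort`.
NOT RH-BEARING. [cite: GuthMaynard2026, Corollary 1.4 and §13.2] -/
theorem GuthMaynard2026_corollary_1_4_of_combinedDensity
    (hcomb : ∀ η : ℝ, 0 < η → ∃ C B T₀ : ℝ, ∀ T : ℝ, T₀ ≤ T → ∀ σ : ℝ, 1 / 2 ≤ σ → σ ≤ 1 →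
      (zetaZeroCountRe σ T : ℝ) ≤ C * T ^ ((30 / 13 + η) * (1 - σ)) * Real.log T ^ B) :
    GuthMaynard2026_corollary_1_4 :=
  GuthMaynard2026_corollary_1_4_of_psiMeanSquareShort
    (GuthMaynard2026_psiMeanSquareShort_of_combinedDensity hcomb)

/-- **Corollary 1.3 from the near-`σ = 1` zero-density interface** `NearOneZeroDensity`
(`ZeroDensityNearOne.lean`; GM's "[J] or [M3]"), via `psiShortIntervals_of_nearOne`.
NOT RH-BEARING. [cite: GuthMaynard2026, Corollary 1.3 and §13.2] -/
theorem GuthMaynard2026_corollary_1_3_of_nearOne (h : NearOneZeroDensity) :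
    GuthMaynard2026_corollary_1_3 :=
  GuthMaynard2026_corollary_1_3_of_psiShortIntervals (psiShortIntervals_of_nearOne h)

/-- **Corollary 1.4 from the near-`σ = 1` zero-density interface** `NearOneZeroDensity`, via
`GuthMaynard2026_psiMeanSquareShort_of_nearOne`. NOT RH-BEARING.
[cite: GuthMaynard2026, Corollary 1.4 and §13.2] -/
theorem GuthMaynard2026_corollary_1_4_of_nearOne (h : NearOneZeroDensity) :
    GuthMaynard2026_corollary_1_4 :=
  GuthMaynard2026_corollary_1_4_of_psiMeanSquareShort (GuthMaynard2026_psiMeanSquareShort_of_nearOne h)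

/-- **Corollary 1.3 from Ivić's Theorem 11.3** (named fact `Ivic1985_theorem11_3`, Ivić 1985 (11.32)),
via `GuthMaynard2026_psiShortIntervals_of_Ivic1985_theorem11_3`. NOT RH-BEARING.
[cite: GuthMaynard2026, Corollary 1.3 and §13.2] -/
theorem GuthMaynard2026_corollary_1_3_of_Ivic1985_theorem11_3 (h : Ivic1985_theorem11_3) :
    GuthMaynard2026_corollary_1_3 :=
  GuthMaynard2026_corollary_1_3_of_psiShortIntervals
    (GuthMaynard2026_psiShortIntervals_of_Ivic1985_theorem11_3 h)

/-- **Corollary 1.4 from Ivić's Theorem 11.3** (named fact `Ivic1985_theorem11_3`), via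
`GuthMaynard2026_psiMeanSquareShort_of_Ivic1985_theorem11_3`. NOT RH-BEARING.
[cite: GuthMaynard2026, Corollary 1.4 and §13.2] -/
theorem GuthMaynard2026_corollary_1_4_of_Ivic1985_theorem11_3 (h : Ivic1985_theorem11_3) :
    GuthMaynard2026_corollary_1_4 :=
  GuthMaynard2026_corollary_1_4_of_psiMeanSquareShort
    (GuthMaynard2026_psiMeanSquareShort_of_Ivic1985_theorem11_3 h)


/-! ### The unconditional forms (Guth–Maynard 2026, (13.3) proved in the tree) -/

/-- **Guth–Maynard 2026, §13.2: `ψ` in all short intervals `[x, x + x^{17/30+ε}]`, UNCONDITIONAL**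
(`GuthMaynard2026_psiShortIntervals`), from the tree proof of (13.3) `GuthMaynard2026_eq_13_3_holds`.
NOT RH-BEARING. [cite: GuthMaynard2026, §13.2 (proof of Corollary 1.3)] -/
theorem GuthMaynard2026_psiShortIntervals_holds : GuthMaynard2026_psiShortIntervals :=
  psiShortIntervals_of_combinedDensity GuthMaynard2026_eq_13_3_holds

/-- **Guth–Maynard 2026, §13.2 eq. (AlmostAllTarget): the `ψ` mean square, UNCONDITIONAL**
(`GuthMaynard2026_psiMeanSquareShort`). NOT RH-BEARING.
[cite: GuthMaynard2026, §13.2 (proof of Corollary 1.4)] -/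
theorem GuthMaynard2026_psiMeanSquareShort_holds : GuthMaynard2026_psiMeanSquareShort :=
  GuthMaynard2026_psiMeanSquareShort_of_combinedDensity GuthMaynard2026_eq_13_3_holds

/-- **Guth–Maynard 2026, Corollary 1.3 (primes in short intervals `[x, x + x^{17/30+ε}]`),
UNCONDITIONAL** — the discharge of the named fact `GuthMaynard2026_corollary_1_3`.
NOT RH-BEARING: a theorem about primes; nothing here bears on the truth of RH.
[cite: GuthMaynard2026, Corollary 1.3] -/
theorem GuthMaynard2026_corollary_1_3_holds : GuthMaynard2026_corollary_1_3 :=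
  GuthMaynard2026_corollary_1_3_of_combinedDensity GuthMaynard2026_eq_13_3_holds

/-- **Guth–Maynard 2026, Corollary 1.4 (primes in almost all short intervals `[x, x + x^{2/15+ε}]`),
UNCONDITIONAL** — the discharge of the named fact `GuthMaynard2026_corollary_1_4`.
NOT RH-BEARING: a theorem about primes; nothing here bears on the truth of RH.
[cite: GuthMaynard2026, Corollary 1.4] -/
theorem GuthMaynard2026_corollary_1_4_holds : GuthMaynard2026_corollary_1_4 :=
  GuthMaynard2026_corollary_1_4_of_combinedDensity GuthMaynard2026_eq_13_3_holds

/-- **Primes in `(x, x + x^{17/30+ε}]` for all large `x`, UNCONDITIONAL** (consequence of Cor. 1.3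
recorded by `exists_prime_mem_Ioc_of_corollary_1_3`). NOT RH-BEARING.
[cite: GuthMaynard2026, Corollary 1.3] -/
theorem GuthMaynard2026_exists_prime_mem_Ioc {ε : ℝ} (hε : 0 < ε) :
    ∃ x₀ : ℝ, ∀ x : ℝ, x₀ ≤ x → ∃ p : ℕ, p.Prime ∧ x < p ∧ (p : ℝ) ≤ x + x ^ (17 / 30 + ε) :=
  exists_prime_mem_Ioc_of_corollary_1_3 GuthMaynard2026_corollary_1_3_holds hε

/-- **Prime gaps `p_{n+1} − p_n ≤ p_n^{17/30+ε}` for all large `n`, UNCONDITIONAL** (consequence of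
Cor. 1.3 recorded by `primeGap_le_rpow_of_corollary_1_3`). NOT RH-BEARING.
[cite: GuthMaynard2026, Corollary 1.3] -/
theorem GuthMaynard2026_primeGap_le_rpow {ε : ℝ} (hε : 0 < ε) :
    ∃ n₀ : ℕ, ∀ n : ℕ, n₀ ≤ n →
      (Nat.nth Nat.Prime (n + 1) : ℝ) - (Nat.nth Nat.Prime n : ℝ) ≤
        (Nat.nth Nat.Prime n : ℝ) ^ (17 / 30 + ε) :=
  primeGap_le_rpow_of_corollary_1_3 GuthMaynard2026_corollary_1_3_holds hε

end Literature.NumberTheory.LFunctions
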